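import Mathlib
import HarnessLib
import Summits.HubbardSuperconductivity.HubbardSuperconductivity.Theorems.KLProgrammeKLRegimeWickConservation
import Summits.HubbardSuperconductivity.HubbardSuperconductivity.Theorems.KLProgrammeKLRegimeWickSecondOrder

/-!
# Route `KLProgramme` — crux K3, ENGINE child gen 5 (stmt-HubbardSuperconductivity-19918 `KLRegimeEngineV14`), stub `stub_engine_step_values`,
# conjunct (E2-v9) at `1 ≤ n`: conservation laws and parity of the Wick-smeared action at REAL cutoff — `kernel_wickActionR_eq_zero_of_*`

Cell gate-hubbard-kl, seat hubbard-kl-k3c1-p1 (g6), technique «composed-map remainder propagation».  The continuous (E2) organisation reads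
p1 g9's three-channel identities (`…WickBubbleColourings*`, `…WickBubbleChannelPP/PH/…Channels`) at the REAL-CUTOFF Wick carrier
`𝒲_Λ := gaussConv ℂ (hubbardCovBelowCT … Λ) (hubbardEffectiveActionCT … Λ)` (`…WickScaleFlow`, p504230), two copies joined by the diagonal
line pair `(Ċ_Λ, D_Λ)` (`…WickScaleFlowLines`, p506794).  Those identities use exactly two structural facts about the carrier: that it is
EVEN, and the four CONSERVATION selection rules (charge, frequency, spin, momentum) of its kernels — stated by p1 for `klWickAction … n`
(the grid, `…WickConservation` p495253).  Here are the same facts at real `Λ` (the grid statements are their instances at `Λ = Λ_n`: `klws_wickActionR_klScale`, `rfl`):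

* `klws_effectiveActionR_mem_evenOdd_zero`, `klws_wickActionR_mem_evenOdd_zero` (parity);
* `klws_map_scaling_wickActionR` (invariance under every non-zero vertex-compatible scaling: `map_scaling_hubbardEffectiveActionCT` +
  `map_scaling_gaussConv` with `scalingWeight_covBelowCT_invariant`, all already real-`Λ` in p1's files);
* `kernel_wickActionR_eq_zero_of_weight_ne`, `…_of_twoPow`, and the four laws `kernel_wickActionR_eq_zero_of_charge/_freq/_spin/_momentum`.

So a generic-`W` (or real-`Λ`) restatement of the channel reading has its hypotheses discharged here.  Token port of p1's §2–§4; nothing about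
the model's physics is asserted.  0 kit.
-/

noncomputable section

namespace Summit.HubbardSuperconductivity.HubbardSuperconductivity.Theorems.KLRegimeWick

set_option linter.dupNamespace false -- summit = problem name (single-conjunct summit), D-0017

open Literature.MathematicalPhysics.QuantumLattice GrassmannAlgebra Finset Matrix
open Literature.Probability.LatticeModels
open Summit.HubbardSuperconductivity.HubbardSuperconductivity.Theorems.TwoPointAssembly
open Summit.HubbardSuperconductivity.HubbardSuperconductivity.Theorems.KLProgrammeLegKernels
open Summit.HubbardSuperconductivity.HubbardSuperconductivity.Theorems.KLRegimeSplit

section Model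

variable {L M : ℕ} [NeZero L] (β U μ : ℝ) (K : TrigPolyC4v)

/-! ## §1 Parity -/

/-- `𝒢^K_Λ` is even (any real cutoff). -/
theorem klws_effectiveActionR_mem_evenOdd_zero (Λ : ℝ) : hubbardEffectiveActionCT L M β U μ 0 K Λ ∈ evenOdd ℂ 0 := by
  rw [hubbardEffectiveActionCT]
  exact effAction_mem_evenOdd_zero ℂ _ (hubbardInteractionCT_mem_evenOdd_zero L M β U K)
    (constPart_hubbardInteractionCT L M β U K)

/-- **The real-cutoff Wick carrier `𝒲_Λ = e^{Δ_{C^K_{≤Λ}}}𝒢^K_Λ` is even.** -/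
theorem klws_wickActionR_mem_evenOdd_zero (Λ : ℝ) :
    gaussConv ℂ (hubbardCovBelowCT L M β μ 0 K Λ) (hubbardEffectiveActionCT L M β U μ 0 K Λ) ∈ evenOdd ℂ 0 :=
  gaussConv_mem_evenOdd ℂ _ (klws_effectiveActionR_mem_evenOdd_zero β U μ K Λ)

/-! ## §2 Invariance under vertex-compatible scalings -/

/-- **`𝒲_Λ` is invariant** under every non-zero vertex-compatible scaling (real-`Λ` twin of `map_scaling_klWickAction`). -/
theorem klws_map_scaling_wickActionR [NeZero M] (φ : FreqMomentum L M × Fin 2 → ℂ) (hφ : ∀ p, φ p ≠ 0)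
    (hV : ∀ k₁ k₂ k₃ k₄ : FreqMomentum L M,
      matsubaraInt M k₁.1 + matsubaraInt M k₃.1 = matsubaraInt M k₂.1 + matsubaraInt M k₄.1 ∧ k₁.2 + k₃.2 = k₂.2 + k₄.2 →
        φ (k₁, 0) * φ (k₃, 1) = φ (k₂, 0) * φ (k₄, 1))
    (Λ : ℝ) :
    ExteriorAlgebra.map (LinearMap.mulLeft ℂ (scalingWeight φ))
        (gaussConv ℂ (hubbardCovBelowCT L M β μ 0 K Λ) (hubbardEffectiveActionCT L M β U μ 0 K Λ)) =
      gaussConv ℂ (hubbardCovBelowCT L M β μ 0 K Λ) (hubbardEffectiveActionCT L M β U μ 0 K Λ) := by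
  have hD : ∀ X Y, scalingWeight φ X * scalingWeight φ Y * hubbardCovBelowCT L M β μ 0 K Λ X Y = hubbardCovBelowCT L M β μ 0 K Λ X Y :=
    fun X Y => scalingWeight_covBelowCT_invariant φ hφ β μ K Λ X Y
  rw [map_scaling_gaussConv φ hD, map_scaling_hubbardEffectiveActionCT φ hφ hV]

/-! ## §3 Selection rules -/

/-- **Selection rule for `𝒲_Λ`**: under a non-zero vertex-compatible weight, the degree-`m` kernel vanishes on every label string of total
weight `≠ 1`. -/
theorem kernel_wickActionR_eq_zero_of_weight_ne [NeZero M] (φ : FreqMomentum L M × Fin 2 → ℂ) (hφ : ∀ p, φ p ≠ 0)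
    (hV : ∀ k₁ k₂ k₃ k₄ : FreqMomentum L M,
      matsubaraInt M k₁.1 + matsubaraInt M k₃.1 = matsubaraInt M k₂.1 + matsubaraInt M k₄.1 ∧ k₁.2 + k₃.2 = k₂.2 + k₄.2 →
        φ (k₁, 0) * φ (k₃, 1) = φ (k₂, 0) * φ (k₄, 1))
    (Λ : ℝ) {m : ℕ} {X : Fin m → HubbardFieldIdx L M} (hw : ∏ i, scalingWeight φ (X i) ≠ 1) :
    kernel ℂ (gaussConv ℂ (hubbardCovBelowCT L M β μ 0 K Λ) (hubbardEffectiveActionCT L M β U μ 0 K Λ)) m X = 0 :=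
  kernel_eq_zero_of_invariant ℂ (scalingWeight φ) (klws_map_scaling_wickActionR β U μ K φ hφ hV Λ) hw

/-- **Selection rule for weights `2^{g}`** at real cutoff. -/
theorem kernel_wickActionR_eq_zero_of_twoPow [NeZero M] (g : FreqMomentum L M × Fin 2 → ℤ)
    (hg : ∀ k₁ k₂ k₃ k₄ : FreqMomentum L M,
      matsubaraInt M k₁.1 + matsubaraInt M k₃.1 = matsubaraInt M k₂.1 + matsubaraInt M k₄.1 ∧ k₁.2 + k₃.2 = k₂.2 + k₄.2 →
        g (k₁, 0) + g (k₃, 1) = g (k₂, 0) + g (k₄, 1))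
    (Λ : ℝ) {m : ℕ} {X : Fin m → HubbardFieldIdx L M} (hX : ∑ i, (if (X i).2 = 0 then (1 : ℤ) else -1) * g (X i).1 ≠ 0) :
    kernel ℂ (gaussConv ℂ (hubbardCovBelowCT L M β μ 0 K Λ) (hubbardEffectiveActionCT L M β U μ 0 K Λ)) m X = 0 := by
  refine kernel_wickActionR_eq_zero_of_weight_ne β U μ K (fun p => (2 : ℂ) ^ g p) (fun p => zpow_ne_zero _ two_ne_zero)
    (twoPow_compatible g hg) Λ ?_
  rw [prod_scalingWeight_two_zpow]
  intro h
  exact hX (two_zpow_injective (h.trans (zpow_zero (2 : ℂ)).symm))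

/-- **CHARGE conservation** at real cutoff: a kernel of `𝒲_Λ` with unequal numbers of `ψ̂⁺` and `ψ̂⁻` vanishes. -/
theorem kernel_wickActionR_eq_zero_of_charge [NeZero M] (Λ : ℝ) {m : ℕ} {X : Fin m → HubbardFieldIdx L M}
    (hX : ∑ i, (if (X i).2 = 0 then (1 : ℤ) else -1) ≠ 0) :
    kernel ℂ (gaussConv ℂ (hubbardCovBelowCT L M β μ 0 K Λ) (hubbardEffectiveActionCT L M β U μ 0 K Λ)) m X = 0 :=
  kernel_wickActionR_eq_zero_of_twoPow β U μ K (fun _ => 1) (fun _ _ _ _ _ => rfl) Λ (by simpa using hX)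

/-- **FREQUENCY conservation** at real cutoff. -/
theorem kernel_wickActionR_eq_zero_of_freq [NeZero M] (Λ : ℝ) {m : ℕ} {X : Fin m → HubbardFieldIdx L M}
    (hX : ∑ i, (if (X i).2 = 0 then (1 : ℤ) else -1) * matsubaraInt M (X i).1.1.1 ≠ 0) :
    kernel ℂ (gaussConv ℂ (hubbardCovBelowCT L M β μ 0 K Λ) (hubbardEffectiveActionCT L M β U μ 0 K Λ)) m X = 0 :=
  kernel_wickActionR_eq_zero_of_twoPow β U μ K (fun p => matsubaraInt M p.1.1) (fun _ _ _ _ h => h.1) Λ hX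

/-- **SPIN conservation** at real cutoff. -/
theorem kernel_wickActionR_eq_zero_of_spin [NeZero M] (Λ : ℝ) {m : ℕ} {X : Fin m → HubbardFieldIdx L M}
    (hX : ∑ i, (if (X i).2 = 0 then (1 : ℤ) else -1) * (if (X i).1.2 = 0 then 1 else 0) ≠ 0) :
    kernel ℂ (gaussConv ℂ (hubbardCovBelowCT L M β μ 0 K Λ) (hubbardEffectiveActionCT L M β U μ 0 K Λ)) m X = 0 :=
  kernel_wickActionR_eq_zero_of_twoPow β U μ K (fun p => if p.2 = 0 then 1 else 0) (fun _ _ _ _ _ => by simp) Λ hX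

/-- **MOMENTUM conservation** at real cutoff, coordinate by coordinate. -/
theorem kernel_wickActionR_eq_zero_of_momentum [NeZero M] (Λ : ℝ) {m : ℕ} {X : Fin m → HubbardFieldIdx L M} (j : Fin 2)
    (hX : ∑ i, (if (X i).2 = 0 then (1 : ℤ) else -1) • (X i).1.1.2 j ≠ 0) :
    kernel ℂ (gaussConv ℂ (hubbardCovBelowCT L M β μ 0 K Λ) (hubbardEffectiveActionCT L M β U μ 0 K Λ)) m X = 0 := by
  refine kernel_wickActionR_eq_zero_of_weight_ne β U μ K (fun p => (ZMod.stdAddChar (p.1.2 j) : ℂ)) (fun p => stdAddChar_ne_zero _)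
    (fun k₁ k₂ k₃ k₄ h => ?_) Λ ?_
  · rw [← AddChar.map_add_eq_mul, ← AddChar.map_add_eq_mul, ← Pi.add_apply k₁.2, ← Pi.add_apply k₂.2, h.2]
  · have hw : ∏ i, scalingWeight (fun p => (ZMod.stdAddChar (p.1.2 j) : ℂ)) (X i) =
        ZMod.stdAddChar (∑ i, (if (X i).2 = 0 then (1 : ℤ) else -1) • (X i).1.1.2 j) := by
      rw [addChar_map_sum]
      refine Finset.prod_congr rfl fun i _ => ?_
      rw [scalingWeight_eq_zpow, AddChar.map_zsmul_eq_zpow]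
    rw [hw]
    intro h
    apply hX
    exact ZMod.injective_stdAddChar (h.trans (AddChar.map_zero_eq_one _).symm)

end Model

end Summit.HubbardSuperconductivity.HubbardSuperconductivity.Theorems.KLRegimeWick

end
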